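import Mathlib
import Summits.NavierStokesRegularity.NavierStokesRegularity.Theorems.LerayQuarterDissipationFiniteDissipationLiouvilleSmallDissipationGap
import Summits.NavierStokesRegularity.NavierStokesRegularity.Theorems.LerayQuarterDissipationFiniteDissipationLiouvilleSliceLSix
import Summits.NavierStokesRegularity.NavierStokesRegularity.Theorems.FiniteDissipationLiouville.Negative.DissLawScaleInvariant
import Literature.Analysis.FluidPDE.TaoEnstrophyLocalisationProofs
import Literature.Analysis.FluidPDE.TypeIAncientMildRescale
import Literature.Analysis.FluidPDE.ChaeAsymptoticallySelfSimilarLocalLeray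
import HarnessLib

/-!
# Crux `FiniteDissipationLiouville` (stmt-NavierStokesRegularity-22144): the whole-space
# `div`–`curl` identity for `L⁶` fields, and `∫ ‖DU(s)‖² ≤ ∫ ‖Ω(s)‖²` on the stratum
# (tools for the vorticity-amplitude threshold, file 1/2)

Theorems file of route `LerayQuarterDissipation` (lead prover g15; `--supports` the crux; tools
for `…VorticityAmplitude`). Navier–Stokes regularity is NOT proved by anything here; no summit is.

`𝒟_{C,K}`: Type-I ancient mild fields `V` in the KNSS gauge (`IsTypeIAncientMild C V`) whose
slices obey the quarter-rate dissipation law `∫ ‖DV(t)‖² ≤ K/√(−t)`; `U = lerayOrbit V`,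
`Ω = lerayVorticity V = curl U` the similarity variables.

* `integral_frobeniusNormSq_fderiv_eq_of_isDivFree` — **`∫ |Dv|²_F = ∫ ‖curl v‖²` for a
  divergence-free `C²` field `v : ℝ³ → ℝ³` with `Dv ∈ L²` and `v ∈ L⁶`** (NOT `v ∈ L²`: the tree's
  `integral_frobeniusNormSq_fderiv_eq_integral_norm_curl_sq` wants `v ∈ L²`, which the similarity
  slices of `𝒟` — `‖U(y)‖ ~ ‖y‖⁻¹` at infinity — do not have). Proof: pointwise
  `|Dv|²_F = ‖curl v‖² + tr(Dv∘Dv)` (`frobeniusNormSq_fderiv_eq_sq_norm_curl_add_trace`); the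
  `div`–`tr` identity against the squared radial cutoff `φ_R²` (`integral_mul_trace_comp_sub_divergence_sq`,
  `div v = 0`) makes `∫φ_R² tr(Dv∘Dv)` a collar flux `−∫ D(φ_R²)(Dv v)`, bounded for every `η > 0` by
  `(c₁/η)∫_{‖y‖≥R}‖Dv‖² + (c₁η/R²)∫_{B̄_{2R}}‖v‖²`, with `∫_{B̄_{2R}}‖v‖² ≤ (8|B̄₁| + ∫‖v‖⁶)R²`
  (`setIntegral_sq_norm_closedBall_le`, pointwise `‖v‖² ≤ 1/R + R²‖v‖⁶`); `R → ∞` (dominated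
  convergence and the `L²` tail of `Dv`) and `η → 0` give `∫ tr(Dv∘Dv) = 0`.
* `integrable_pow_six_norm_lerayOrbit` — the similarity slices of a member of `𝒟` are in `L⁶`
  (`U(s)` is the `t = −1` slice of the rescaled member `V_{e^{−s/2}} ∈ 𝒟_{C,K}`; `Birth.memLp_six_slice`);
  `norm_lerayVorticity_le_of_vorticity_le` — `(−t)‖curl V‖ ≤ C_ω` reads `‖Ω‖ ≤ C_ω`.
* `integral_sq_norm_fderiv_lerayOrbit_le` — **on `𝒟`: `∫ ‖DU(s)‖² ≤ ∫ ‖Ω(s)‖²` for every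
  similarity slice** (operator norm `≤` Frobenius norm, `sq_opNorm_le_frobeniusNormSq`).

References: Doering–Gibbon 1995 §1.4 (1.4.20)–(1.4.21); Majda–Bertozzi 2002 Prop. 2.16;
Koch–Nadirashvili–Seregin–Šverák, Acta Math. 203 (2009) §4 (the class). [folklore energy method]
-/

noncomputable section

set_option linter.dupNamespace false

namespace Summit.NavierStokesRegularity.NavierStokesRegularity.Theorems.FiniteDissipationLiouville.VorticityAmplitude

open MeasureTheory Set Filter Topology Metric InnerProductSpace Function Real
open scoped RealInnerProductSpace ContDiff ENNReal Laplacian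
open Literature.Analysis Literature.Analysis.FluidPDE
open Summit.NavierStokesRegularity.NavierStokesRegularity.Theorems
open Summit.NavierStokesRegularity.NavierStokesRegularity.Theorems.GaussianGap
open Summit.NavierStokesRegularity.NavierStokesRegularity.Theorems.SimilarityEnstrophy
open Summit.NavierStokesRegularity.NavierStokesRegularity.Theorems.SmallDissipationGap

variable {C : ℝ} {V : ℝ → (EuclideanSpace ℝ (Fin 3)) → (EuclideanSpace ℝ (Fin 3))}

/-! ### The whole-space `div`–`curl` identity for `L⁶` fields with `L²` gradient -/

section DivCurl

/-- `a² ≤ 1/R + R² a⁶` for `a ≥ 0`, `R > 0` (if `a² > 1/R` then `R a² > 1` and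
`R²a⁶ = a² (R a²)² ≥ a²`). [folklore] -/
theorem sq_le_inv_add_sq_mul_pow_six (a : ℝ) {R : ℝ} (hR : 0 < R) :
    a ^ 2 ≤ 1 / R + R ^ 2 * a ^ 6 := by
  rcases le_or_gt (a ^ 2) (1 / R) with h | h
  · have : 0 ≤ R ^ 2 * a ^ 6 := by positivity
    linarith
  · have h1 : 1 < R * a ^ 2 := by
      have := (div_lt_iff₀ hR).1 h
      linarith
    have h2 : 0 ≤ a ^ 2 := sq_nonneg a
    have h3 : a ^ 2 ≤ R ^ 2 * a ^ 6 := by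
      have e : R ^ 2 * a ^ 6 = a ^ 2 * (R * a ^ 2) ^ 2 := by ring
      rw [e]
      have h4 : 1 ≤ (R * a ^ 2) ^ 2 := by nlinarith
      nlinarith
    have : 0 ≤ 1 / R := by positivity
    linarith

/-- **`L²` mass of an `L⁶` field on a ball grows at most like `R²`**:
`∫_{B̄_{2R}} ‖v‖² ≤ (8|B̄₁| + ∫ ‖v‖⁶) R²` for `R > 0` (pointwise `‖v‖² ≤ 1/R + R²‖v‖⁶`;
`|B̄₁|` the volume of the closed unit ball).
[folklore] -/
theorem setIntegral_sq_norm_closedBall_le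
    {v : (EuclideanSpace ℝ (Fin 3)) → (EuclideanSpace ℝ (Fin 3))} (hv : Continuous v)
    (h6 : Integrable fun y => ‖v y‖ ^ 6) {R : ℝ} (hR : 0 < R) :
    ∫ y in closedBall (0 : EuclideanSpace ℝ (Fin 3)) (2 * R), ‖v y‖ ^ 2 ≤
      (8 * (volume (closedBall (0 : EuclideanSpace ℝ (Fin 3)) 1)).toReal + ∫ y, ‖v y‖ ^ 6) * R ^ 2 := by
  set B := closedBall (0 : EuclideanSpace ℝ (Fin 3)) (2 * R) with hB
  have hBm : MeasurableSet B := measurableSet_closedBall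
  have hBfin : volume B < ⊤ := measure_closedBall_lt_top
  have hvol : volume.real B = (2 * R) ^ 3 * (volume (closedBall (0 : EuclideanSpace ℝ (Fin 3)) 1)).toReal := by
    rw [measureReal_def, hB, Measure.addHaar_closedBall' volume (0 : EuclideanSpace ℝ (Fin 3))
      (by positivity : (0:ℝ) ≤ 2 * R), ENNReal.toReal_mul, finrank_euclideanSpace_fin,
      ENNReal.toReal_ofReal (by positivity)]
  have hi2 : IntegrableOn (fun y => ‖v y‖ ^ 2) B volume :=
    (hv.norm.pow 2).continuousOn.integrableOn_compact (isCompact_closedBall _ _)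
  have hi6 : IntegrableOn (fun y => ‖v y‖ ^ 6) B volume := h6.integrableOn
  have hic : IntegrableOn (fun _ : EuclideanSpace ℝ (Fin 3) => (1 / R : ℝ)) B volume :=
    integrableOn_const hBfin.ne
  calc ∫ y in B, ‖v y‖ ^ 2 ≤ ∫ y in B, (1 / R + R ^ 2 * ‖v y‖ ^ 6) :=
        setIntegral_mono_on hi2 (hic.add (hi6.const_mul _)) hBm
          fun y _ => sq_le_inv_add_sq_mul_pow_six _ hR
    _ = volume.real B * (1 / R) + R ^ 2 * ∫ y in B, ‖v y‖ ^ 6 := by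
        rw [integral_add hic (hi6.const_mul _), setIntegral_const, integral_const_mul, smul_eq_mul]
    _ ≤ volume.real B * (1 / R) + R ^ 2 * ∫ y, ‖v y‖ ^ 6 :=
        add_le_add_right (mul_le_mul_of_nonneg_left
          (setIntegral_le_integral h6 (Eventually.of_forall fun y => by positivity)) (sq_nonneg R)) _
    _ = (8 * (volume (closedBall (0 : EuclideanSpace ℝ (Fin 3)) 1)).toReal + ∫ y, ‖v y‖ ^ 6) * R ^ 2 := by
        rw [hvol]; field_simp; ring

/-- The squared radial cutoff `φ_R²` is constant `= 1` near every point of the open ball `B(0,R)`,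
so its derivative vanishes there. [folklore] -/
theorem fderiv_sqCutoff_eq_zero_of_lt {R : ℝ} (hR : 0 < R) {y : EuclideanSpace ℝ (Fin 3)}
    (hy : ‖y‖ < R) :
    fderiv ℝ (fun z : (EuclideanSpace ℝ (Fin 3)) => smoothTransition (2 - ‖z‖ ^ 2 / R ^ 2) ^ 2) y = 0 := by
  have hmem : ball (0 : EuclideanSpace ℝ (Fin 3)) R ∈ 𝓝 y :=
    isOpen_ball.mem_nhds (by rwa [mem_ball, dist_zero_right])
  have hev : (fun z : (EuclideanSpace ℝ (Fin 3)) => smoothTransition (2 - ‖z‖ ^ 2 / R ^ 2) ^ 2) =ᶠ[𝓝 y]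
      fun _ => (1 : ℝ) := by
    filter_upwards [hmem] with z hz
    rw [mem_ball, dist_zero_right] at hz
    exact sqCutoff_eq_one hR hz.le
  rw [hev.fderiv_eq]
  exact fderiv_const_apply _

/-- **The whole-space `div`–`curl` identity for divergence-free fields with `Dv ∈ L²`, `v ∈ L⁶`.**
For a `C²` divergence-free field `v : ℝ³ → ℝ³` with `∫‖Dv‖² < ∞` and `∫‖v‖⁶ < ∞`:
`∫ |Dv|²_F = ∫ ‖curl v‖²`. Pointwise `|Dv|²_F = ‖curl v‖² + tr(Dv∘Dv)`
(`frobeniusNormSq_fderiv_eq_sq_norm_curl_add_trace`); against the squared radial cutoff the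
`div`–`tr` identity (`integral_mul_trace_comp_sub_divergence_sq`, `div v = 0`) reads
`∫ φ_R² tr(Dv∘Dv) = −∫ D(φ_R²)(Dv v)`, a collar flux bounded by
`(c₁/η)∫_{‖y‖≥R}‖Dv‖² + (c₁η/R²)∫_{B̄_{2R}}‖v‖² ≤ (c₁/η)·tail + c₁η(8|B̄₁| + ∫‖v‖⁶)` for every
`η > 0`; `R → ∞` (dominated convergence, `L²` tail of `Dv`) and `η → 0` give `∫ tr(Dv∘Dv) = 0`.
[cite: DoeringGibbon1995, §1.4 eq. (1.4.20)–(1.4.21)] [cite: MajdaBertozziCUP2002, Prop. 2.16 (proof)] -/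
theorem integral_frobeniusNormSq_fderiv_eq_of_isDivFree
    {v : (EuclideanSpace ℝ (Fin 3)) → (EuclideanSpace ℝ (Fin 3))} (hv : ContDiff ℝ 2 v)
    (hdiv : VectorCalculus.IsDivFree v) (hD : Integrable fun y => ‖fderiv ℝ v y‖ ^ 2)
    (h6 : Integrable fun y => ‖v y‖ ^ 6) :
    ∫ y, frobeniusNormSq (fderiv ℝ v y) = ∫ y, ‖curl v y‖ ^ 2 := by
  have hv1 : ContDiff ℝ 1 v := hv.of_le (by norm_cast)
  have hcv : Continuous v := hv.continuous
  have hcD : Continuous (fderiv ℝ v) := hv1.continuous_fderiv one_ne_zero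
  have hcF : Continuous fun y => frobeniusNormSq (fderiv ℝ v y) :=
    continuous_frobeniusNormSq_fderiv hv (by simp)
  have hcC : Continuous fun y => ‖curl v y‖ ^ 2 := (continuous_curl hv1).norm.pow 2
  -- the trace term `T = |Dv|²_F − ‖curl v‖²`
  set T : (EuclideanSpace ℝ (Fin 3)) → ℝ := fun y => traceCLM ((fderiv ℝ v y).comp (fderiv ℝ v y)) with hTdef
  have hT : ∀ y, T y = frobeniusNormSq (fderiv ℝ v y) - ‖curl v y‖ ^ 2 := fun y => by
    rw [hTdef, frobeniusNormSq_fderiv_eq_sq_norm_curl_add_trace]; ring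
  have hiF : Integrable fun y => frobeniusNormSq (fderiv ℝ v y) :=
    (hD.const_mul 3).mono' hcF.aestronglyMeasurable (Eventually.of_forall fun y => by
      rw [Real.norm_of_nonneg (frobeniusNormSq_nonneg _)]
      exact ChaeLocalLeray.frobeniusNormSq_le_three _)
  have hiC : Integrable fun y => ‖curl v y‖ ^ 2 :=
    (hD.const_mul (‖curlCLM‖ ^ 2)).mono' hcC.aestronglyMeasurable (Eventually.of_forall fun y => by
      rw [Real.norm_of_nonneg (sq_nonneg _), ← mul_pow]
      exact pow_le_pow_left₀ (norm_nonneg _) (norm_curl_le v y) 2)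
  have hcT : Continuous T := by
    rw [show T = fun y => frobeniusNormSq (fderiv ℝ v y) - ‖curl v y‖ ^ 2 from funext hT]
    exact hcF.sub hcC
  have hiT : Integrable T := by
    rw [show T = fun y => frobeniusNormSq (fderiv ℝ v y) - ‖curl v y‖ ^ 2 from funext hT]
    exact hiF.sub hiC
  suffices hT0 : ∫ y, T y = 0 by
    have e : ∫ y, frobeniusNormSq (fderiv ℝ v y) = ∫ y, (‖curl v y‖ ^ 2 + T y) :=
      integral_congr_ae (Eventually.of_forall fun y => by
        show frobeniusNormSq (fderiv ℝ v y) = ‖curl v y‖ ^ 2 + T y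
        rw [hT]; ring)
    rw [e, integral_add hiC hiT, hT0, add_zero]
  -- constants
  obtain ⟨c₁, hc₁0, hc₁⟩ :=
    exists_norm_fderiv_smoothTransition_cutoff_le (E := (EuclideanSpace ℝ (Fin 3)))
  set cB : ℝ := (volume (closedBall (0 : EuclideanSpace ℝ (Fin 3)) 1)).toReal with hcBdef
  have hcB0 : 0 ≤ cB := ENNReal.toReal_nonneg
  set N₆ : ℝ := ∫ y, ‖v y‖ ^ 6 with hN₆def
  have hN₆0 : 0 ≤ N₆ := integral_nonneg fun y => by positivity
  -- the tail of `‖Dv‖²`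
  set tail : ℝ → ℝ := fun R => ∫ y in (ball (0 : EuclideanSpace ℝ (Fin 3)) R)ᶜ, ‖fderiv ℝ v y‖ ^ 2
    with htaildef
  have htail0 : ∀ R, 0 ≤ tail R := fun R => integral_nonneg fun y => sq_nonneg _
  have htail_lim : Tendsto (fun n : ℕ => tail n) atTop (𝓝 0) := by
    have h := tendsto_setIntegral_of_antitone (μ := (volume : Measure (EuclideanSpace ℝ (Fin 3))))
      (s := fun n : ℕ => (ball (0 : EuclideanSpace ℝ (Fin 3)) n)ᶜ)
      (f := fun y => ‖fderiv ℝ v y‖ ^ 2) (fun n => measurableSet_ball.compl)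
      (fun m n hmn => compl_subset_compl.2 (ball_subset_ball (by exact_mod_cast hmn)))
      ⟨0, hD.integrableOn⟩
    have hempty : (⋂ n : ℕ, (ball (0 : EuclideanSpace ℝ (Fin 3)) (n : ℝ))ᶜ) = ∅ := by
      rw [← compl_iUnion, iUnion_ball_nat, compl_univ]
    rw [hempty, Measure.restrict_empty, integral_zero_measure] at h
    exact h
  -- the collar flux bound, for every `R > 0`, `η > 0`
  have hflux : ∀ R : ℝ, 0 < R → ∀ η : ℝ, 0 < η →
      |∫ y, smoothTransition (2 - ‖y‖ ^ 2 / R ^ 2) ^ 2 * T y| ≤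
        c₁ / η * tail R + c₁ * η * (8 * cB + N₆) := by
    intro R hR η hη
    set φ2 : (EuclideanSpace ℝ (Fin 3)) → ℝ := fun z => smoothTransition (2 - ‖z‖ ^ 2 / R ^ 2) ^ 2
      with hφ2def
    have hφ2 : ContDiff ℝ 1 φ2 := contDiff_sqCutoff (n := 1) R
    have hφ2c : HasCompactSupport φ2 := hasCompactSupport_sqCutoff hR
    -- the `div`–`tr` identity with `div v = 0`
    have hid := integral_mul_trace_comp_sub_divergence_sq hv hφ2 hφ2c
    have hdiv' : ∀ x, VectorCalculus.divergence v x = 0 := hdiv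
    simp_rw [hdiv', zero_pow two_ne_zero, sub_zero, zero_smul, sub_zero] at hid
    change ∫ y, φ2 y * T y = -∫ y, fderiv ℝ φ2 y (fderiv ℝ v y (v y)) at hid
    rw [hid, abs_neg]
    -- pointwise bound of the flux integrand
    have hDφ : ∀ y, ‖fderiv ℝ φ2 y‖ ≤ 2 * (c₁ / R) := fun y => norm_fderiv_sqCutoff_le hc₁ hR y
    have hDφin : ∀ y, ‖y‖ < R → fderiv ℝ φ2 y = 0 := fun y hy => fderiv_sqCutoff_eq_zero_of_lt hR hy
    have hDφout : ∀ y ∉ closedBall (0 : EuclideanSpace ℝ (Fin 3)) (2 * R), fderiv ℝ φ2 y = 0 :=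
      fun y hy => fderiv_sqCutoff_eq_zero hR hy
    set g₁ : (EuclideanSpace ℝ (Fin 3)) → ℝ :=
      (ball (0 : EuclideanSpace ℝ (Fin 3)) R)ᶜ.indicator fun y => ‖fderiv ℝ v y‖ ^ 2 with hg₁def
    set g₂ : (EuclideanSpace ℝ (Fin 3)) → ℝ :=
      (closedBall (0 : EuclideanSpace ℝ (Fin 3)) (2 * R)).indicator fun y => ‖v y‖ ^ 2 with hg₂def
    have hpt : ∀ y, ‖fderiv ℝ φ2 y (fderiv ℝ v y (v y))‖ ≤ c₁ / η * g₁ y + c₁ * η / R ^ 2 * g₂ y := by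
      intro y
      by_cases hin : ‖y‖ < R
      · rw [hDφin y hin, zero_apply, norm_zero]
        have : 0 ≤ g₁ y := Set.indicator_nonneg (fun _ _ => sq_nonneg _) y
        have : 0 ≤ g₂ y := Set.indicator_nonneg (fun _ _ => sq_nonneg _) y
        positivity
      by_cases hout : y ∈ closedBall (0 : EuclideanSpace ℝ (Fin 3)) (2 * R)
      · have e1 : g₁ y = ‖fderiv ℝ v y‖ ^ 2 := by
          rw [hg₁def, indicator_of_mem]
          rw [mem_compl_iff, mem_ball, dist_zero_right]; exact hin
        have e2 : g₂ y = ‖v y‖ ^ 2 := by rw [hg₂def, indicator_of_mem hout]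
        rw [e1, e2]
        set a := ‖fderiv ℝ v y‖
        set b := ‖v y‖
        have ha : 0 ≤ a := norm_nonneg _
        have hb : 0 ≤ b := norm_nonneg _
        calc ‖fderiv ℝ φ2 y (fderiv ℝ v y (v y))‖ ≤ ‖fderiv ℝ φ2 y‖ * ‖fderiv ℝ v y (v y)‖ :=
              ContinuousLinearMap.le_opNorm _ _
          _ ≤ (2 * (c₁ / R)) * (a * b) := by
              gcongr
              · exact hDφ y
              · exact ContinuousLinearMap.le_opNorm _ _
          _ = c₁ * (2 * (a / Real.sqrt η) * (Real.sqrt η * b / R)) := by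
              have hs : Real.sqrt η ≠ 0 := (Real.sqrt_pos.2 hη).ne'
              field_simp
          _ ≤ c₁ * ((a / Real.sqrt η) ^ 2 + (Real.sqrt η * b / R) ^ 2) :=
              mul_le_mul_of_nonneg_left (two_mul_le_add_sq _ _) hc₁0
          _ = c₁ / η * a ^ 2 + c₁ * η / R ^ 2 * b ^ 2 := by
              rw [div_pow, div_pow, mul_pow, Real.sq_sqrt hη.le]
              field_simp
      · rw [hDφout y hout, zero_apply, norm_zero]
        have : 0 ≤ g₁ y := Set.indicator_nonneg (fun _ _ => sq_nonneg _) y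
        have : 0 ≤ g₂ y := Set.indicator_nonneg (fun _ _ => sq_nonneg _) y
        positivity
    have hig₁ : Integrable g₁ := hD.indicator measurableSet_ball.compl
    have hig₂ : Integrable g₂ :=
      ((hcv.norm.pow 2).continuousOn.integrableOn_compact (isCompact_closedBall _ _)).integrable_indicator
        measurableSet_closedBall
    have hI₁ : ∫ y, g₁ y = tail R := integral_indicator measurableSet_ball.compl
    have hI₂ : ∫ y, g₂ y = ∫ y in closedBall (0 : EuclideanSpace ℝ (Fin 3)) (2 * R), ‖v y‖ ^ 2 :=
      integral_indicator measurableSet_closedBall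
    calc |∫ y, fderiv ℝ φ2 y (fderiv ℝ v y (v y))|
        = ‖∫ y, fderiv ℝ φ2 y (fderiv ℝ v y (v y))‖ := (Real.norm_eq_abs _).symm
      _ ≤ ∫ y, ‖fderiv ℝ φ2 y (fderiv ℝ v y (v y))‖ := norm_integral_le_integral_norm _
      _ ≤ ∫ y, (c₁ / η * g₁ y + c₁ * η / R ^ 2 * g₂ y) := by
          refine integral_mono_of_nonneg (Eventually.of_forall fun y => norm_nonneg _)
            ((hig₁.const_mul _).add (hig₂.const_mul _)) (Eventually.of_forall hpt)
      _ = c₁ / η * tail R + c₁ * η / R ^ 2 *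
            ∫ y in closedBall (0 : EuclideanSpace ℝ (Fin 3)) (2 * R), ‖v y‖ ^ 2 := by
          rw [integral_add (hig₁.const_mul _) (hig₂.const_mul _), integral_const_mul,
            integral_const_mul, hI₁, hI₂]
      _ ≤ c₁ / η * tail R + c₁ * η / R ^ 2 * ((8 * cB + N₆) * R ^ 2) := by
          gcongr
          exact setIntegral_sq_norm_closedBall_le hcv h6 hR
      _ = c₁ / η * tail R + c₁ * η * (8 * cB + N₆) := by
          field_simp
  -- `∫ φ_n² T → ∫ T` by dominated convergence
  have hconv : Tendsto (fun n : ℕ => ∫ y, smoothTransition (2 - ‖y‖ ^ 2 / ((n : ℝ) + 1) ^ 2) ^ 2 * T y)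
      atTop (𝓝 (∫ y, T y)) := by
    refine tendsto_integral_of_dominated_convergence (fun y => |T y|)
      (fun n => ((contDiff_sqCutoff (n := 1) ((n : ℝ) + 1)).continuous.mul hcT).aestronglyMeasurable)
      hiT.abs (fun n => Eventually.of_forall fun y => ?_) (Eventually.of_forall fun y => ?_)
    · rw [Real.norm_eq_abs, abs_mul, abs_of_nonneg (sqCutoff_nonneg _ y)]
      exact mul_le_of_le_one_left (abs_nonneg _) (sqCutoff_le_one _ y)
    · have hev : ∀ᶠ n : ℕ in atTop, smoothTransition (2 - ‖y‖ ^ 2 / ((n : ℝ) + 1) ^ 2) ^ 2 * T y = T y := by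
        filter_upwards [eventually_ge_atTop ⌈‖y‖⌉₊] with n hn
        have hyn : ‖y‖ ≤ (n : ℝ) + 1 := (Nat.le_ceil ‖y‖).trans (by exact_mod_cast Nat.le_succ_of_le hn)
        rw [sqCutoff_eq_one (by positivity) hyn, one_mul]
      exact tendsto_const_nhds.congr' (EventuallyEq.symm hev)
  -- conclusion: `|∫ T| ≤ c₁ η (8 cB + N₆)` for every `η > 0`
  have hle : ∀ η : ℝ, 0 < η → |∫ y, T y| ≤ c₁ * η * (8 * cB + N₆) := by
    intro η hη
    have h1 : Tendsto (fun n : ℕ => |∫ y, smoothTransition (2 - ‖y‖ ^ 2 / ((n : ℝ) + 1) ^ 2) ^ 2 * T y|)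
        atTop (𝓝 |∫ y, T y|) := hconv.abs
    have h2 : Tendsto (fun n : ℕ => c₁ / η * tail ((n : ℝ) + 1) + c₁ * η * (8 * cB + N₆)) atTop
        (𝓝 (c₁ / η * 0 + c₁ * η * (8 * cB + N₆))) := by
      have ht : Tendsto (fun n : ℕ => tail ((n : ℝ) + 1)) atTop (𝓝 0) := by
        have := htail_lim.comp (tendsto_add_atTop_nat 1)
        refine this.congr fun n => ?_
        simp [Function.comp, Nat.cast_add, Nat.cast_one]
      exact (ht.const_mul _).add tendsto_const_nhds
    rw [mul_zero, zero_add] at h2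
    exact le_of_tendsto_of_tendsto' h1 h2 fun n => hflux ((n : ℝ) + 1) (by positivity) η hη
  have habs : |∫ y, T y| ≤ 0 := by
    refine le_of_forall_pos_le_add fun ε hε => ?_
    have hpos : 0 < c₁ * (8 * cB + N₆) + 1 := by positivity
    have h := hle (ε / (c₁ * (8 * cB + N₆) + 1)) (div_pos hε hpos)
    have e : c₁ * (ε / (c₁ * (8 * cB + N₆) + 1)) * (8 * cB + N₆) =
        ε * (c₁ * (8 * cB + N₆) / (c₁ * (8 * cB + N₆) + 1)) := by ring
    have hlt : c₁ * (8 * cB + N₆) / (c₁ * (8 * cB + N₆) + 1) ≤ 1 := by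
      rw [div_le_one hpos]; linarith
    rw [e] at h
    have : ε * (c₁ * (8 * cB + N₆) / (c₁ * (8 * cB + N₆) + 1)) ≤ ε * 1 :=
      mul_le_mul_of_nonneg_left hlt hε.le
    linarith
  exact abs_eq_zero.1 (le_antisymm habs (abs_nonneg _))

end DivCurl

/-! ### The similarity slices of `𝒟`: `∫ ‖DU(s)‖² ≤ ∫ ‖Ω(s)‖²` -/

section Slices

/-- `|Dv|²_F ∈ L¹` as soon as `‖Dv‖² ∈ L¹` (`|Dv|²_F ≤ 3‖Dv‖²`). [folklore] -/
theorem integrable_frobeniusNormSq_fderiv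
    {v : (EuclideanSpace ℝ (Fin 3)) → (EuclideanSpace ℝ (Fin 3))} (hv : ContDiff ℝ 1 v)
    (hD : Integrable fun y => ‖fderiv ℝ v y‖ ^ 2) :
    Integrable fun y => frobeniusNormSq (fderiv ℝ v y) :=
  (hD.const_mul 3).mono' (continuous_frobeniusNormSq_fderiv hv (by simp)).aestronglyMeasurable
    (Eventually.of_forall fun y => by
      rw [Real.norm_of_nonneg (frobeniusNormSq_nonneg _)]
      exact ChaeLocalLeray.frobeniusNormSq_le_three _)

/-- A similarity slice is the `t = −1` slice of a rescaled member:
`lerayOrbit V s = nsRescale (e^{−s/2}) V (−1)`. [folklore] -/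
theorem lerayOrbit_eq_nsRescale_neg_one (V : ℝ → (EuclideanSpace ℝ (Fin 3)) → (EuclideanSpace ℝ (Fin 3)))
    (s : ℝ) : lerayOrbit V s = nsRescale (Real.exp (-s / 2)) V (-1) := by
  funext y
  have h2 : Real.exp (-s / 2) ^ 2 = Real.exp (-s) := by
    rw [← Real.exp_nat_mul]; congr 1; push_cast; ring
  rw [lerayOrbit_apply, nsRescale_apply, h2, mul_neg_one]

/-- **The similarity slices of a member of `𝒟_{C,K}` are in `L⁶`**: `∫ ‖U(s)‖⁶ < ∞` for every `s`
(the slice `U(s)` is the `t = −1` slice of the rescaled member `V_{e^{−s/2}} ∈ 𝒟_{C,K}`, which is in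
`L⁶` by `Birth.memLp_six_slice`). [folklore] -/
theorem integrable_pow_six_norm_lerayOrbit (hV : IsTypeIAncientMild C V) {K : ℝ}
    (hK : ∀ t : ℝ, t < 0 → ∫⁻ x, ‖fderiv ℝ (V t) x‖ₑ ^ 2 ≤ ENNReal.ofReal (K / Real.sqrt (-t)))
    (s : ℝ) : Integrable fun y => ‖lerayOrbit V s y‖ ^ 6 := by
  obtain ⟨CL, -, h⟩ := FiniteDissipationLiouville.Birth.memLp_six_slice
  have hc : 0 < Real.exp (-s / 2) := Real.exp_pos _
  have hmem := (h C K _ (hV.nsRescale hc) (FiniteDissipationLiouville.Negative.dissLaw_nsRescale hc hK)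
    (-1) (by norm_num)).1
  rw [lerayOrbit_eq_nsRescale_neg_one]
  exact hmem.integrable_norm_pow (p := 6) (by norm_num)

/-- **On the stratum the Dirichlet integral of a similarity slice is at most its enstrophy**:
`∫ ‖DU(s)‖² ≤ ∫ ‖Ω(s)‖²` for every `s` (operator norm `≤` Frobenius norm, and
`∫ |DU|²_F = ∫ ‖curl U‖²` by `integral_frobeniusNormSq_fderiv_eq_of_isDivFree`: `U(s)` is `C²`,
divergence free, `DU(s) ∈ L²` by the law, `U(s) ∈ L⁶`). [folklore] -/
theorem integral_sq_norm_fderiv_lerayOrbit_le (hV : IsTypeIAncientMild C V) {K : ℝ}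
    (hK : ∀ t : ℝ, t < 0 → ∫⁻ x, ‖fderiv ℝ (V t) x‖ₑ ^ 2 ≤ ENNReal.ofReal (K / Real.sqrt (-t)))
    (s : ℝ) :
    ∫ y, ‖fderiv ℝ (lerayOrbit V s) y‖ ^ 2 ≤ ∫ y, ‖lerayVorticity V s y‖ ^ 2 := by
  have hU2 : ContDiff ℝ 2 (lerayOrbit V s) := mustSqueeze_contDiff_lerayOrbit_slice hV s (n := 2)
  have hU1 : ContDiff ℝ 1 (lerayOrbit V s) := mustSqueeze_contDiff_lerayOrbit_slice hV s (n := 1)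
  have hdiv : VectorCalculus.IsDivFree (lerayOrbit V s) :=
    (isDivFree_lerayOrbit_iff V s).2 (hV.isDivFree (neg_neg_of_pos (Real.exp_pos _)))
  obtain ⟨hint, -⟩ := integrable_sq_norm_fderiv_lerayOrbit hV hK s
  have h6 := integrable_pow_six_norm_lerayOrbit hV hK s
  have hid := integral_frobeniusNormSq_fderiv_eq_of_isDivFree hU2 hdiv hint h6
  calc ∫ y, ‖fderiv ℝ (lerayOrbit V s) y‖ ^ 2 ≤ ∫ y, frobeniusNormSq (fderiv ℝ (lerayOrbit V s) y) :=
        integral_mono hint (integrable_frobeniusNormSq_fderiv hU1 hint) fun y =>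
          sq_opNorm_le_frobeniusNormSq _
    _ = ∫ y, ‖lerayVorticity V s y‖ ^ 2 := by rw [hid]; rfl

/-- From the physical bound `(−t)‖curl V(t,x)‖ ≤ C_ω` to the similarity bound `‖Ω(s,y)‖ ≤ C_ω`
(`Ω(s,y) = (−t)·curl V(t,x)` at `t = −e^{−s}`, `x = e^{−s/2}y`, `curl_lerayOrbit`). [folklore] -/
theorem norm_lerayVorticity_le_of_vorticity_le {Cω : ℝ}
    (hω : ∀ t : ℝ, t < 0 → ∀ x, (-t) * ‖curl (V t) x‖ ≤ Cω) (s : ℝ) (y : EuclideanSpace ℝ (Fin 3)) :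
    ‖lerayVorticity V s y‖ ≤ Cω := by
  have ht : -Real.exp (-s) < 0 := neg_neg_of_pos (Real.exp_pos _)
  have h := hω _ ht (Real.exp (-s / 2) • y)
  rw [neg_neg] at h
  rw [lerayVorticity_apply, curl_lerayOrbit, norm_smul, Real.norm_of_nonneg (Real.exp_pos _).le]
  exact h

end Slices

end Summit.NavierStokesRegularity.NavierStokesRegularity.Theorems.FiniteDissipationLiouville.VorticityAmplitude

end
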